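import Mathlib
import Summits.QuantumFields.YangMills.Theorems.TransportFieldFanoVacuumConcentrationRpowArith
import Summits.QuantumFields.YangMills.Theorems.TransportFieldFanoVacuumTorelonCeiling
import Summits.QuantumFields.YangMills.Theorems.LuscherReductionTwistedTraceScalingValleyGainRecord
import HarnessLib

/-!
# Concentration of the exact vacuum at EVERY polynomial radius `β^{−p}`, `0 < p < 1/5`, and the torelon ceiling `E_{Ω²}[F] ≤ (18L²+4)·β^{−2p}`
# (route `TransportFieldFano`, LINE g17-A, crux ⟨stmt-QuantumFields-23353⟩ `MeanLoopCeilingWeak` helper lane; sequel to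
# ✓`…TransportFieldFanoVacuumTorelonCeiling` (exponent `2/39`) — here every exponent `< 2/5`; the registered BC5 rung asks `1/2`)

FTR's ✓`GroundConc.groundState_outer_mass_le` runs the two-layer onion (✓`GroundConc.layer_mass_le`) at RED's ledger radius `β^{−1/39}`
(✓`valleyGainAt_pow_of_two_le`, exponent window `p < 1/10` with side conditions forcing `p ≲ 1/31`).  Lane A of S-BASE has since landed the
valley gain at EVERY core radius `β^{−a}`, `0 < a < 1/5` (✓`TwoLattice.ConstTube.valleyGain_record`, eight thin shells on ✓`hOD_record_low`).
This file re-runs the SAME two layers at that radius: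
* ★★★ `groundState_outer_mass_le_rpow (hL : 2 ≤ L) (hp0 : 0 < p) (hp5 : p < 1/5)` — for `β ≥ β₀(L,p)`, every physical `Ω` with `K_βΩ = λ₀Ω`
  has `‖sin Θ_{3β^{−p}}·Ω‖² ≤ β^{−1/2}·‖Ω‖²`: the vacuum mass outside the `3β^{−p}`-windows of the eight central orbits is `O(β^{−1/2})`
  (one layer costs `≍ β^{2p−2/3}` = IMS defect `ρ^{−2}β^{−1}` over the gain `λ_b(L³β) ≍ β^{−1/3}`; two layers `β^{4p−4/3} ≤ β^{−1/2}/2` iff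
  `p < 5/24`, and `1/5 < 5/24`; arithmetic in ✓`VacuumConc.endgame_real_rpow` / ✓`two_layer_arith_gen`);
* ★★★ `vacuum_torelon_mean_le_rpow` — `E_{Ω²}[F] ≤ (18L² + 4)·β^{−2p}` for `β ≥ β₀(L,p)`, every `l2`-normalised physical exact vacuum, every
  `0 < p < 1/5` (split ✓`l2_torelon_mul_vacuum_le_inner_outer` at `δ = 3β^{−p}`: `2(L·3β^{−p})² + 4β^{−1/2}`, and `2p < 1/2`); sitewise
  `vacuum_torelonAt_mean_le_rpow`;
* ★★ `fixedTorusRung_of_lt_two_fifths` — the registered rung's letters with ANY exponent `q < 2/5` in place of `1/2`, at EVERY `L₀ ≥ 2`.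
So the Polyakov holonomy of the exact zero-flux vacuum sits within `β^{−1/5+}` of the centre on every fixed torus; the Lüscher scale is `β^{−1/3}`,
and the rung's `β^{−1/2}` (door threshold `> 11/24`) would need the valley gain at radii `β^{−a}`, `a ≥ 1/4` — beyond lane A's `a < 1/5`
(✓`innerShellGainSmallAt_record` needs `b < 1/5`), i.e. an eigen-scale outer coercivity on the torus; NOT claimed.
HONEST FRAMING: fixed-lattice helper theorems over landed FTR/RED/S-BASE estimates (`--supports 23353`); no registered stub is closed by name;
nothing about infinite volume, the continuum or the Yang–Mills mass gap; no summit statement.  No `sorry`, no new definition, no named fact.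
References: [cite: SimonB1983DiscreteSpectrum, §3]; [cite: Luscher1983, §2–3]; [cite: LuscherMunster1984, §2].
-/

set_option autoImplicit false

noncomputable section

open MeasureTheory Filter Topology Real
open scoped Matrix BigOperators
open Literature.MathematicalPhysics.QuantumFieldTheory hiding SU2
open Literature.MathematicalPhysics.QuantumLattice

namespace Summit.QuantumFields.YangMills.Theorems.TransportFieldFano

namespace VacuumConc

open Summit.QuantumFields.YangMills.Theorems.FemtoTransferGap
open Summit.QuantumFields.YangMills.Theorems.FemtoTransferGap.OffTube
open Summit.QuantumFields.YangMills.Theorems.FemtoTransferGap.GroundConc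
open Summit.QuantumFields.YangMills.Theorems.FemtoCutoffLadder

variable {L : ℕ} [NeZero L]

/-! ## §1 Concentration of the exact ground state at radius `3β^{−p}`, `0 < p < 1/5` -/

set_option maxHeartbeats 1600000 in
/-- ★★★ **CONCENTRATION OF THE EXACT GROUND STATE AT EVERY POLYNOMIAL RADIUS** (`L ≥ 2`, `0 < p < 1/5`): for `β ≥ β₀(L,p)` every physical `Ω`
with `K_βΩ = λ₀Ω` has `‖sin Θ_{3ρ}·Ω‖² ≤ β^{−1/2}·‖Ω‖²`, `ρ = β^{−p}` — the mass of the ground state outside the `3ρ`-neighbourhoods of the eight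
twisted pure-gauge orbits is `O(β^{−1/2}‖Ω‖²)`.  Two onion layers (✓`GroundConc.layer_mass_le` at `ρ` then `3ρ`) on the record valley gain
✓`TwoLattice.ConstTube.valleyGain_record` at radius `β^{−p}` (gain `1 − e^{−λ_b(L³β)}`), the second layer's IMS defect paid on the first layer's
mass; the real arithmetic is ✓`endgame_real_rpow`. [cite: SimonB1983DiscreteSpectrum, §3] [cite: Luscher1983, §2–3] [cite: LuscherMunster1984, §2] -/
theorem groundState_outer_mass_le_rpow (hL : 2 ≤ L) {p : ℝ} (hp0 : 0 < p) (hp5 : p < 1 / 5) :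
    ∃ β0 : ℝ, ∀ β : ℝ, β0 ≤ β → ∀ Ω : GaugeConfig 3 L SU2 → ℝ, IsPhys Ω →
      transferApply β Ω = topValue su2Rep L β • Ω →
      l2 (fun U => Real.sin (innerPhase (3 * powScale p β) U) * Ω U)
          (fun U => Real.sin (innerPhase (3 * powScale p β) U) * Ω U) ≤ β ^ (-(1 : ℝ) / 2) * l2 Ω Ω := by
  have hL0 : (0 : ℝ) < L := by exact_mod_cast Nat.pos_of_ne_zero (NeZero.ne L)
  have hL3 : (8 : ℝ) ≤ (L : ℝ) ^ 3 := by
    have h2 : (2 : ℝ) ≤ L := by exact_mod_cast hL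
    have h := pow_le_pow_left₀ (by norm_num : (0 : ℝ) ≤ 2) h2 3
    norm_num at h
    exact h
  set n : ℕ := Fintype.card (Edge 3 L) with hn
  have hn0 : (0 : ℝ) < n := by rw [hn]; exact_mod_cast Fintype.card_pos
  set f : ℝ := uniformFloorConst L with hf
  have hf0 : 0 < f := uniformFloorConst_pos (L := L)
  set w : ℝ := Real.exp (-(1 / 2 : ℝ)) * (8 / (3 * π ^ 3)) with hw
  have hw0 : 0 < w := by positivity
  -- the RECORD valley gain at radius `β^{−p}`, `A = 1`
  obtain ⟨βV, hV⟩ := TwoLattice.ConstTube.valleyGain_record hL hp0 hp5 1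
  -- constants and thresholds
  set cL : ℝ := (2 / (L : ℝ) ^ 3) ^ ((1 : ℝ) / 3) with hcL
  have hcL0 : 0 < cL := by positivity
  have ha1 : 0 < 5 / 6 - 4 * p := by linarith
  have ha2 : 0 < 2 / 3 - 2 * p := by linarith
  have hs3 : 0 < 1 - 2 * p := by linarith
  obtain ⟨β1, h1⟩ := eventually_rpow_dominates (a := 5 / 6 - 4 * p) (b := 0) (k := 0)
    (C := 2 * ((6 * (n : ℝ) ^ 2 * (8 * π) ^ 2 / f) / cL) ^ 2) ha1 ha1
  obtain ⟨β2, h2⟩ := eventually_rpow_dominates (a := 2 / 3 - 2 * p) (b := 0) (k := 0)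
    (C := (6 * (n : ℝ) ^ 2 * (8 * π) ^ 2 / f) / cL) ha2 ha2
  obtain ⟨β3, h3⟩ := superpoly_small (16 * (4 * (L : ℝ) ^ 3 / f) * (4 / w) ^ n) (2 * n + 2) (c := 1 / (8 * n)) (s := 1 - 2 * p) (ε := 1)
    (by positivity) hs3 one_pos
  obtain ⟨β4, h4⟩ := superpoly_small (16 * (4 * (L : ℝ) ^ 3 / f) * (1 + 4 * (L : ℝ) ^ 3)) 3 (c := 1) (s := 3 / 20) (ε := 1)
    one_pos (by norm_num) one_pos
  obtain ⟨β5, h5⟩ := superpoly_small (16 / f) 1 (c := 1) (s := 3 / 20) (ε := 1) one_pos (by norm_num) one_pos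
  refine ⟨max βV (max β1 (max β2 (max β3 (max β4 β5)))), fun β hβ Ω hΩ heig => ?_⟩
  have hβV : βV ≤ β := (le_max_left _ _).trans hβ
  obtain ⟨hβ1, h1β⟩ := h1 β ((le_max_left _ _).trans ((le_max_right _ _).trans hβ))
  obtain ⟨-, h2β⟩ := h2 β ((le_max_left _ _).trans ((le_max_right _ _).trans ((le_max_right _ _).trans hβ)))
  obtain ⟨-, h3β⟩ := h3 β ((le_max_left _ _).trans ((le_max_right _ _).trans ((le_max_right _ _).trans ((le_max_right _ _).trans hβ))))
  obtain ⟨-, h4β⟩ := h4 β ((le_max_left _ _).trans ((le_max_right _ _).trans ((le_max_right _ _).trans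
    ((le_max_right _ _).trans ((le_max_right _ _).trans hβ)))))
  obtain ⟨-, h5β⟩ := h5 β ((le_max_right _ _).trans ((le_max_right _ _).trans ((le_max_right _ _).trans
    ((le_max_right _ _).trans ((le_max_right _ _).trans hβ)))))
  clear h1 h2 h3 h4 h5
  simp only [zero_mul, add_zero, Real.rpow_zero, mul_one] at h1β h2β
  simp only [one_mul, pow_one] at h4β h5β
  have hβ0 : 0 < β := by linarith
  -- the scales
  set ρ : ℝ := powScale p β with hρdef
  have hρ : ρ = β ^ (-p) := powScale_eq hβ1
  have hρ0 : 0 < ρ := powScale_pos _ _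
  have h3ρ0 : 0 < 3 * ρ := by positivity
  set η : ℝ := powScale (17 / 20) β with hηdef
  have hη : η = β ^ (-(17 / 20 : ℝ)) := powScale_eq hβ1
  have hη0 : 0 < η := powScale_pos _ _
  set u : ℝ := bareLambda ((L : ℝ) ^ 3 * β) with hudef
  have hB2 : 2 ≤ (L : ℝ) ^ 3 * β := by nlinarith
  have hu01 := bareLambda_pos_le_one hB2
  have hu0 : 0 < u := hu01.1
  have hu1 : u ≤ 1 := hu01.2
  have hu : u = cL * β ^ (-(1 : ℝ) / 3) := bareLambda_cube_eq (L := L) hβ0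
  have hinvu : 1 / u ≤ (L : ℝ) ^ 3 * β := by
    have hx0 : 0 < 2 / ((L : ℝ) ^ 3 * β) := by positivity
    have hx1 : 2 / ((L : ℝ) ^ 3 * β) ≤ 1 := by rw [div_le_one (by positivity)]; linarith
    have hux : 2 / ((L : ℝ) ^ 3 * β) ≤ u := by
      have h := Real.rpow_le_rpow_of_exponent_ge hx0 hx1 (show (1 : ℝ) / 3 ≤ 1 by norm_num)
      rw [Real.rpow_one] at h
      exact h
    have h1 : 1 / u ≤ 1 / (2 / ((L : ℝ) ^ 3 * β)) := one_div_le_one_div_of_le hx0 hux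
    rw [one_div_div] at h1
    have h3 : (L : ℝ) ^ 3 * β / 2 ≤ (L : ℝ) ^ 3 * β := by
      have : 0 ≤ (L : ℝ) ^ 3 * β := by positivity
      linarith
    exact h1.trans h3
  set γ : ℝ := 1 - Real.exp (-u) with hγdef
  have hγu : u / 2 ≤ γ := by
    have h1 : 1 + u ≤ Real.exp u := by have := Real.add_one_le_exp u; linarith
    have h2 : Real.exp (-u) * Real.exp u = 1 := by rw [← Real.exp_add]; simp
    have h3 : 0 < Real.exp (-u) := Real.exp_pos _
    have h4 : Real.exp (-u) * (1 + u) ≤ 1 := by nlinarith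
    rw [hγdef]; nlinarith
  have hγ0 : 0 < γ := by linarith
  set lam : ℝ := topValue su2Rep L β with hlam
  have hlam0 : 0 < lam := topValue_su2Rep_pos L β
  have hlat0 : 0 < latCE L β := latCE_pos (L := L) hβ0.le
  have hlamf : f * latCE L β ≤ lam := by
    have h := levelValue_zero_ge_uniform (L := L) hβ1
    rwa [levelValue_zero] at h
  -- the GAIN on tube states away from the `r`-neighbourhoods, `r ≥ ρ`
  have hgain : ∀ r : ℝ, 0 < r → ρ ≤ r → ∀ φ : GaugeConfig 3 L SU2 → ℝ, IsPhys φ →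
      (∀ U, φ U ≠ 0 → wilsonAction su2Rep U ≤ η ∧ Real.sin (innerPhase r U) ≠ 0) →
      qform su2Rep β φ φ ≤ (1 - γ) * lam * l2 φ φ := by
    intro r hr0 hr φ hφ hsupp
    have h := hV β hβV φ hφ (fun U hU => ?_)
    · have e : (1 - γ) * lam = Real.exp (-(1 * u)) * levelValue su2Rep L β 0 := by
        rw [levelValue_zero, hγdef, one_mul]; ring
      rw [e]; exact h
    · obtain ⟨hS, hsin⟩ := hsupp U hU
      refine ⟨by linarith, fun z => ?_⟩
      have := forall_lt_orbitDist_of_sin_ne_zero hr0 hsin z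
      linarith
  -- cut-off bookkeeping for `sin Θ_r`
  have hsm : ∀ r : ℝ, Measurable fun U : GaugeConfig 3 L SU2 => Real.sin (innerPhase r U) :=
    fun r => Real.continuous_sin.measurable.comp (measurable_innerPhase r)
  have hsb : ∀ (r : ℝ) (U : GaugeConfig 3 L SU2), |Real.sin (innerPhase r U)| ≤ 1 := fun r U => Real.abs_sin_le_one _
  have hsg : ∀ (r : ℝ) (k : Site 3 L → SU2) (U : GaugeConfig 3 L SU2),
      Real.sin (innerPhase r (gaugeTransform k U)) = Real.sin (innerPhase r U) := fun r k U => by rw [innerPhase_gaugeTransform]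
  have hsz : ∀ (r : ℝ) (k : Fin 3), ∀ z ∈ Subgroup.center SU2, ∀ U : GaugeConfig 3 L SU2,
      Real.sin (innerPhase r (twist k z U)) = Real.sin (innerPhase r U) := fun r k z hz U => by rw [innerPhase_twist r k hz]
  have hsLip : ∀ r : ℝ, 0 < r → ∀ U V : GaugeConfig 3 L SU2,
      |Real.sin (innerPhase r U) - Real.sin (innerPhase r V)| ≤
        (8 * π / r) * ∑ e, frobNorm ((U e : Matrix (Fin 2) (Fin 2) ℂ) - (V e : Matrix (Fin 2) (Fin 2) ℂ)) :=
    fun r hr U V => (Real.abs_sin_sub_sin_le _ _).trans (abs_innerPhase_sub_le hr U V)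
  have hs0 : ∀ (r : ℝ) (U : GaugeConfig 3 L SU2), 0 ≤ Real.sin (innerPhase r U) := fun r U =>
    Real.sin_nonneg_of_nonneg_of_le_pi (innerPhase_mem r U).1 ((innerPhase_mem r U).2.trans (by linarith [Real.pi_pos]))
  have hs1 : ∀ (r : ℝ) (U : GaugeConfig 3 L SU2), Real.sin (innerPhase r U) ≤ 1 := fun r U => Real.sin_le_one _
  -- LAYER 1: `g = sin Θ_ρ`, `g₁ = 1`
  have hL1 := layer_mass_le hβ0 hΩ heig (g := fun U => Real.sin (innerPhase ρ U)) (g₁ := fun _ => (1 : ℝ))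
    (hsm ρ) (hsb ρ) (hsg ρ) (hsz ρ) (Λ := 8 * π / ρ) (hsLip ρ hρ0) measurable_const (fun _ => zero_le_one) (fun _ => le_rfl)
    (fun _ _ => rfl) (fun _ _ _ _ => rfl) (fun _ _ => rfl) (R := ρ / 2) (by positivity) (fun _ _ _ h => absurd rfl h) η hγ0
    (hgain ρ hρ0 le_rfl)
  have e1 : (fun U : GaugeConfig 3 L SU2 => (1 : ℝ) * Ω U) = Ω := by funext U; ring
  rw [e1] at hL1
  -- LAYER 2: `g = sin Θ_{3ρ}`, `g₁ = sin Θ_ρ`, separation `ρ/2`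
  have hgg₁ : ∀ U : GaugeConfig 3 L SU2, Real.sin (innerPhase (3 * ρ) U) ≠ 0 → Real.sin (innerPhase ρ U) = 1 := fun U hU =>
    sin_innerPhase_eq_one_of_sin_ne_zero h3ρ0 hρ0 (by linarith) hU
  have hloc : ∀ U V : GaugeConfig 3 L SU2, Real.sin (innerPhase (3 * ρ) U) ≠ 0 → Real.sin (innerPhase ρ V) ≠ 1 →
      ρ / 2 ≤ ∑ e : Edge 3 L, frobNorm (((U e : SU2) : Matrix (Fin 2) (Fin 2) ℂ) - ((V e : SU2) : Matrix (Fin 2) (Fin 2) ℂ)) := by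
    intro U V hU hV1
    have hU' := forall_lt_orbitDist_of_sin_ne_zero h3ρ0 hU
    have hV' : ∃ z : Fin 3 → Bool, orbitDist (TT.twist3 z V) < ρ := by
      by_contra h
      push Not at h
      exact hV1 (sin_innerPhase_eq_one hρ0 h)
    have h := sum_frobNorm_ge_of_orbitDist hU' hV'
    linarith
  have hL2 := layer_mass_le hβ0 hΩ heig (g := fun U => Real.sin (innerPhase (3 * ρ) U)) (g₁ := fun U => Real.sin (innerPhase ρ U))
    (hsm (3 * ρ)) (hsb (3 * ρ)) (hsg (3 * ρ)) (hsz (3 * ρ)) (Λ := 8 * π / (3 * ρ)) (hsLip (3 * ρ) h3ρ0) (hsm ρ) (hs0 ρ) (hs1 ρ)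
    (hsg ρ) (hsz ρ) hgg₁ (R := ρ / 2) (by positivity) hloc η hγ0 (hgain (3 * ρ) h3ρ0 (by linarith))
  clear hV hgain hsm hsb hsg hsz hsLip hs0 hs1 hgg₁ hloc e1
  -- the cross-copy bound in polynomial × stretched-exponential form
  have hββ : ∀ x : ℝ, β * β ^ x = β ^ (1 + x) := fun x => by rw [Real.rpow_add hβ0, Real.rpow_one]
  have hexp1 : β / 2 * ((ρ / 2) ^ 2 / n) = 1 / (8 * n) * β ^ (1 - 2 * p) := by
    rw [hρ]
    have e : (β ^ (-p) / 2) ^ 2 = β ^ (-p * (2 : ℕ)) / 4 := by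
      rw [div_pow, ← Real.rpow_mul_natCast hβ0.le]; norm_num
    rw [e]
    have e2 : β * β ^ (-p * (2 : ℕ)) = β ^ (1 - 2 * p) := by
      rw [hββ]; congr 1; push_cast; ring
    rw [← e2]
    field_simp
    ring
  have hcb_le : crossBound L β (ρ / 2) ≤
      (4 / w) ^ n * β ^ (2 * n) * Real.exp (-(1 / (8 * n) * β ^ (1 - 2 * p))) * latCE L β := by
    have h := crossBound_le_poly_latCE (L := L) hβ1 (ρ / 2)
    rw [← hn, hexp1] at h
    have e : (4 * β ^ 2 / (Real.exp (-(1 / 2 : ℝ)) * (8 / (3 * π ^ 3)))) ^ n = (4 / w) ^ n * β ^ (2 * n) := by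
      rw [hw, pow_mul, ← mul_pow]; congr 1; field_simp
    rw [e] at h
    exact h
  -- the endgame
  obtain ⟨hmain, he₂', hcb', hk', ht'⟩ := endgame_real_rpow n (lam := lam) (γ := γ) (p := p) hβ1 hn0 hf0 hw0 hlat0 hlamf hu0 hcL0 hu
    (by positivity) hinvu hρ hη hγu (crossBound_pos (L := L) β (ρ / 2)).le hcb_le h1β h2β h3β h4β h5β
  -- `1/(16β) ≤ β^{−1/2}/16`
  have hθ0 : 0 ≤ β ^ (-(1 : ℝ) / 2) := Real.rpow_nonneg hβ0.le _
  have hθβ : 1 / (16 * β) ≤ β ^ (-(1 : ℝ) / 2) / 16 := by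
    have h1 : β ^ (-(1 : ℝ)) ≤ β ^ (-(1 : ℝ) / 2) := Real.rpow_le_rpow_of_exponent_le hβ1 (by norm_num)
    rw [Real.rpow_neg_one] at h1
    have e : 1 / (16 * β) = β⁻¹ / 16 := by field_simp
    rw [e]; linarith
  have hfin := two_layer_arith_gen (l2_self_nonneg Ω) hθ0 (by positivity : (0 : ℝ) ≤ 2 / (γ * lam))
    (crossBound_pos (L := L) β (ρ / 2)).le (by positivity) (by positivity) (by positivity) hL1 hL2 hmain he₂'
    (hcb'.trans hθβ) (hk'.trans hθβ) (ht'.trans hθβ)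
  simpa only [hρdef] using hfin

/-! ## §2 The vacuum torelon ceiling with every exponent below `2/5` -/

/-- Real arithmetic: for `β ≥ 1` and `2p ≤ 1/2`, `2(L'·3β^{−p})²·1 + 4·β^{−1/2} ≤ (18L'² + 4)·β^{−2p}`. [folklore] -/
theorem ceiling_arith_rpow {β p : ℝ} (hβ : 1 ≤ β) (hp : 2 * p ≤ 1 / 2) (L' : ℝ) :
    2 * (L' * (3 * β ^ (-p))) ^ 2 * 1 + 4 * (β ^ (-(1 : ℝ) / 2) * 1) ≤ (18 * L' ^ 2 + 4) * β ^ (-(2 * p)) := by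
  have hβ0 : 0 < β := by linarith
  have hsq : (β ^ (-p)) ^ 2 = β ^ (-(2 * p)) := by
    rw [← Real.rpow_natCast, ← Real.rpow_mul hβ0.le]; congr 1; push_cast; ring
  have hinv : β ^ (-(1 : ℝ) / 2) ≤ β ^ (-(2 * p)) := Real.rpow_le_rpow_of_exponent_le hβ (by linarith)
  have hpos : 0 ≤ β ^ (-(2 * p)) := Real.rpow_nonneg hβ0.le _
  have e : 2 * (L' * (3 * β ^ (-p))) ^ 2 * 1 = 18 * L' ^ 2 * β ^ (-(2 * p)) := by rw [← hsq]; ring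
  rw [e]
  nlinarith [sq_nonneg L']

/-- ★★★ **VACUUM TORELON CEILING WITH EXPONENT `2p`, EVERY `p < 1/5`, EVERY `L ≥ 2`**: there is `β₀(L,p)` such that for `β ≥ β₀`, every physical
`l2`-normalised `Ω` with `K_βΩ = λ₀Ω` has `E_{Ω²}[F] ≤ (18L² + 4)·β^{−2p}`, `F = flowLift 0 (4 − (Re tr P)²)`.  Split
✓`l2_torelon_mul_vacuum_le_inner_outer` at `δ = 3β^{−p}` + ★★★ `groundState_outer_mass_le_rpow`. [cite: Luscher1983, §2–3] [cite: SimonB1983DiscreteSpectrum, §3] -/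
theorem vacuum_torelon_mean_le_rpow (hL : 2 ≤ L) {p : ℝ} (hp0 : 0 < p) (hp5 : p < 1 / 5) :
    ∃ β₀ : ℝ, ∀ β : ℝ, β₀ ≤ β → ∀ Ω : GaugeConfig 3 L SU2 → ℝ, IsPhys Ω → l2 Ω Ω = 1 →
      transferApply β Ω = topValue su2Rep L β • Ω →
        l2 (fun U => flowLift 0 (fun u : GaugeConfig 3 1 SU2 => 4 - ((su2Rep (u ((0 : Site 3 1), (0 : Fin 3)))).trace.re) ^ 2) U * Ω U) Ω ≤
          (18 * (L : ℝ) ^ 2 + 4) * β ^ (-(2 * p)) := by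
  obtain ⟨β0, h0⟩ := groundState_outer_mass_le_rpow hL hp0 hp5
  refine ⟨max β0 1, fun β hβ Ω hΩ hn heig => ?_⟩
  have hβ0 : β0 ≤ β := (le_max_left _ _).trans hβ
  have hβ1 : 1 ≤ β := (le_max_right _ _).trans hβ
  have hρ : powScale p β = β ^ (-p) := powScale_eq hβ1
  have hδ : 0 < 3 * powScale p β := by have := powScale_pos p β; positivity
  have hsplit := l2_torelon_mul_vacuum_le_inner_outer hδ hΩ
  have hout := h0 β hβ0 Ω hΩ heig
  rw [hn] at hsplit hout
  have harith := ceiling_arith_rpow (p := p) hβ1 (by linarith) (L : ℝ)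
  rw [← hρ] at harith
  linarith

/-- ★★★ The same ceiling at ONE base point: `E_{Ω²}[d_x] ≤ (18L² + 4)·β^{−2p}`, every site `x`, every `0 < p < 1/5`.
[cite: Luscher1983, §2–3] [cite: SimonB1983DiscreteSpectrum, §3] -/
theorem vacuum_torelonAt_mean_le_rpow (hL : 2 ≤ L) {p : ℝ} (hp0 : 0 < p) (hp5 : p < 1 / 5) :
    ∃ β₀ : ℝ, ∀ β : ℝ, β₀ ≤ β → ∀ Ω : GaugeConfig 3 L SU2 → ℝ, IsPhys Ω → l2 Ω Ω = 1 →
      transferApply β Ω = topValue su2Rep L β • Ω → ∀ x : Site 3 L,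
        l2 (fun U => flowLiftAt x 0 (fun u : GaugeConfig 3 1 SU2 => 4 - ((su2Rep (u ((0 : Site 3 1), (0 : Fin 3)))).trace.re) ^ 2) U * Ω U) Ω ≤
          (18 * (L : ℝ) ^ 2 + 4) * β ^ (-(2 * p)) := by
  obtain ⟨β0, h0⟩ := groundState_outer_mass_le_rpow hL hp0 hp5
  refine ⟨max β0 1, fun β hβ Ω hΩ hn heig x => ?_⟩
  have hβ0 : β0 ≤ β := (le_max_left _ _).trans hβ
  have hβ1 : 1 ≤ β := (le_max_right _ _).trans hβ
  have hρ : powScale p β = β ^ (-p) := powScale_eq hβ1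
  have hδ : 0 < 3 * powScale p β := by have := powScale_pos p β; positivity
  have hsplit := l2_torelonAt_mul_vacuum_le_inner_outer hδ x hΩ
  have hout := h0 β hβ0 Ω hΩ heig
  rw [hn] at hsplit hout
  have harith := ceiling_arith_rpow (p := p) hβ1 (by linarith) (L : ℝ)
  rw [← hρ] at harith
  linarith

/-! ## §3 The registered rung's letters with every exponent `q < 2/5`, at every `L₀ ≥ 2` -/

/-- ★★ **The fixed-torus rung of `MeanLoopCeilingWeak` at every exponent `q < 2/5`** (registered `FixedTorusRungP` of ⟨23353⟩ reads `−1/2`):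
for every `L₀ ≥ 2` and `0 < q < 2/5` there are `C, β₀` with `E_{Ω²}[F] ≤ C·β^{−q}` for `β ≥ β₀`, `L = L₀`, every physical `l2`-normalised exact
vacuum. [cite: Luscher1983, §2–3] [cite: SimonB1983DiscreteSpectrum, §3] -/
theorem fixedTorusRung_of_lt_two_fifths (L₀ : ℕ) (hL₀ : 2 ≤ L₀) {q : ℝ} (hq0 : 0 < q) (hq : q < 2 / 5) :
    ∃ C β₀ : ℝ, ∀ β : ℝ, β₀ ≤ β → ∀ (L : ℕ) [NeZero L], L = L₀ →
      ∀ Ω : Literature.MathematicalPhysics.QuantumFieldTheory.GaugeConfig 3 L SU2 → ℝ, IsPhys Ω → l2 Ω Ω = 1 →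
        transferApply β Ω = topValue su2Rep L β • Ω →
        let F : Literature.MathematicalPhysics.QuantumFieldTheory.GaugeConfig 3 L SU2 → ℝ :=
          flowLift 0 (fun u : Literature.MathematicalPhysics.QuantumFieldTheory.GaugeConfig 3 1 SU2 =>
            4 - ((su2Rep (u ((0 : Literature.MathematicalPhysics.QuantumFieldTheory.Site 3 1), (0 : Fin 3)))).trace.re) ^ 2)
        l2 (fun U => F U * Ω U) Ω ≤ C * β ^ (-q) := by
  haveI : NeZero L₀ := ⟨by omega⟩
  obtain ⟨β₀, h⟩ := vacuum_torelon_mean_le_rpow (L := L₀) hL₀ (p := q / 2) (by linarith) (by linarith)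
  refine ⟨18 * (L₀ : ℝ) ^ 2 + 4, β₀, fun β hβ L _ hL Ω hΩ hn heig => ?_⟩
  subst hL
  have e : -(2 * (q / 2)) = -q := by ring
  have h' := h β hβ Ω hΩ hn heig
  rw [e] at h'
  exact h'

end VacuumConc

end Summit.QuantumFields.YangMills.Theorems.TransportFieldFano

end
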